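import Summits.BirchSwinnertonDyer.BirchSwinnertonDyer.Theorems.GenusKolyvaginAtTwoEquivariantKolyvaginExactAtTwoVisiblePairInputReductions
import Summits.BirchSwinnertonDyer.BirchSwinnertonDyer.Theorems.GenusKolyvaginAtTwoEquivariantKolyvaginExactAtTwoSelmerDescentSplit
import HarnessLib

/-!
# Route `GenusKolyvaginAtTwo`, LINE 6, KEY crux Q3 (inner statement of stmt-BirchSwinnertonDyer-22137):
# the Lemma-4.3 inputs of the pair instance at the places SPLIT in `K` — second reduction of
# `Input.loc_c₁_fin` / `Input.loc_c₂_fin` (`…VisiblePairAtTwoDefs`) to the `K`-statement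

Helper (seat `bsd-line-gk2-p3` g12; `--supports` the crux, closes nothing). Sequel to `…VisiblePairInputReductions`
(p640947) using `…SelmerDescentSplit`: at a place `v` of `ℚ` where `d_K` is a square in `ℚ_v` (every `v ∣ N` by the
Heegner hypothesis; `v = 2` when `d_K ≡ 1 (mod 8)`; every odd `v ∤ d_K` with `(d_K/v) = 1`) the ℚ-level Selmer
condition of BOTH members follows from the `K`-level condition of `c_K(m)` with NO hypothesis on the reduction at
`v`:

* `mem_selmerLocalKer_of_K_of_sq` (member `E`), `mem_selmerLocalKer_twin_of_K_of_sq` (member `E^{(d_K)}`, through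
  `hPsiKT`);
* `loc_c₁_fin_of_K_of_sq`, `loc_c₂_fin_of_K_of_sq` — the fields `Input.loc_c₁_fin`, `Input.loc_c₂_fin` from Lemma
  4.3 over `K`, the descent identities, the DEF-free hypothesis at the primes of `d_K` (member `E`), and RESIDUAL
  ℚ-hypotheses only at the places where `d_K` is NOT a square in `ℚ_v` AND (`v ∋ 2` or `v` bad) — for the Heegner
  field: `v = 2` inert — plus, for the twin, the primes of `d_K`.

THEOREMS ONLY (no definition, no named fact, no `sorry`, standard axioms). BSD is not proved by any of this.

References: [McCallumLMS1991] §4 Lemma 4.3; [GrossLMS1991] §3 (3.1), Prop. 6.2 (1); [Kolyvagin1989Izv] §3.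
-/

set_option autoImplicit false
set_option linter.dupNamespace false -- tree convention: `Summit.BirchSwinnertonDyer.BirchSwinnertonDyer.Theorems` (summit = sub-problem)

noncomputable section

open scoped Classical

namespace Summit.BirchSwinnertonDyer.BirchSwinnertonDyer.Theorems.GenusExact.VisiblePairAtTwo

open WeierstrassCurve NumberField IsDedekindDomain Field Rat.HeightOneSpectrum
open Literature.NumberTheory.EllipticCurves Literature.NumberTheory.GaloisRepresentations
open Literature.NumberTheory.EllipticCurves.KolyvaginDescent
open Summit.BirchSwinnertonDyer.BirchSwinnertonDyer.Theorems.GenusExact.SelmerDescent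
open Summit.BirchSwinnertonDyer.BirchSwinnertonDyer.Theorems.GenusExact.EigenClassesFinite

variable {K : Type} [Field K] [NumberField K] (W : WeierstrassCurve ℚ)

/-! ## §1 One split place at a time -/

/-- **Member `E` at a place where `c` is a square in `ℚ_v`** (`K = ℚ(θ)`, `θ² = c ∈ ℤ`; any reduction, any `n`):
the ℚ-level Selmer condition of `u` at `v` from the `K`-level condition of `c_K = res u` at the places above `v`.
[cite: McCallumLMS1991, §4 Lemma 4.3] -/
theorem mem_selmerLocalKer_of_K_of_sq (h2 : Module.finrank ℚ K = 2) {θ : K}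
    (hθ : θ ∉ (algebraMap ℚ K).range) {c : ℤ} (hc : θ ^ 2 = algebraMap ℚ K c) (n : ℤ)
    {u : galH1Torsion W n} {cK : galH1Torsion (W.baseChange K) n} (hu : resTorsion W K n u = cK)
    (v : HeightOneSpectrum (𝓞 ℚ)) (hs : ∃ s : v.adicCompletion ℚ, s ^ 2 = algebraMap ℚ (v.adicCompletion ℚ) c)
    (hK : ∀ (w : HeightOneSpectrum (𝓞 K)) [w.asIdeal.LiesOver v.asIdeal],
      cK ∈ selmerLocalKer (W.baseChange K) (w.adicCompletion K) n) :
    u ∈ selmerLocalKer W (v.adicCompletion ℚ) n := by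
  obtain ⟨w, hw⟩ := exists_liesOver K v
  exact mem_selmerLocalKer_of_resTorsion_mem_quadratic_of_sq W h2 hθ hc n v w hs (hu ▸ hK w)

/-- **Member `E^{(c')}` at a place where `c` is a square in `ℚ_v`** (any reduction, any `n`): the ℚ-level Selmer
condition of `y` at `v` from the `K`-level condition of `c_K = hPsiKT (res y)` at the places above `v`.
[cite: McCallumLMS1991, §4 Lemma 4.3] [cite: SilvermanAEC2009, X.5 Cor. 5.4] -/
theorem mem_selmerLocalKer_twin_of_K_of_sq (h2 : Module.finrank ℚ K = 2) {θ₀ : K}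
    (hθ₀ : θ₀ ∉ (algebraMap ℚ K).range) {c : ℤ} (hc₀ : θ₀ ^ 2 = algebraMap ℚ K c)
    {θ : K} {c' : ℚ} (hθ : θ ∉ Set.range (algebraMap ℚ K)) (hc : θ ^ 2 = algebraMap ℚ K c') (n : ℤ)
    {y : galH1Torsion (W.quadraticTwist c') n} {cK : galH1Torsion (W.baseChange K) n}
    (hy : hPsiKT W K hθ hc n (resTorsion (W.quadraticTwist c') K n y) = cK) (v : HeightOneSpectrum (𝓞 ℚ))
    (hs : ∃ s : v.adicCompletion ℚ, s ^ 2 = algebraMap ℚ (v.adicCompletion ℚ) c)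
    (hK : ∀ (w : HeightOneSpectrum (𝓞 K)) [w.asIdeal.LiesOver v.asIdeal],
      cK ∈ selmerLocalKer (W.baseChange K) (w.adicCompletion K) n) :
    y ∈ selmerLocalKer (W.quadraticTwist c') (v.adicCompletion ℚ) n := by
  obtain ⟨w, hw⟩ := exists_liesOver K v
  have hx : resTorsion (W.quadraticTwist c') K n y ∈
      selmerLocalKer ((W.quadraticTwist c').baseChange K) (w.adicCompletion K) n := by
    rw [mem_selmerLocalKer_iff_hPsiKT_mem W K hθ hc n (w.adicCompletion K), hy]
    exact hK w
  exact mem_selmerLocalKer_of_resTorsion_mem_quadratic_of_sq (W.quadraticTwist c') h2 hθ₀ hc₀ n v w hs hx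

/-! ## §2 The `Input` fields, split places discharged -/

section Fields

variable [W.IsElliptic] [W.IsGloballyMinimal] {M : ℕ} {θ : K} (hθ : θ ∉ Set.range (algebraMap ℚ K))
  (hθsq : θ ^ 2 = algebraMap ℚ K ((NumberField.discr K : ℤ) : ℚ))

include hθ hθsq in
/-- **`Input.loc_c₁_fin` from Lemma 4.3 over `K`**, residual ℚ-hypothesis only where `d_K` is not a square in `ℚ_v`
and `v ∋ 2` or `v` is bad for `E` (for the Heegner field: `v = 2` inert); DEF-free hypothesis at the primes of `d_K`.
[cite: McCallumLMS1991, §4 Lemma 4.3] [cite: Kolyvagin1989Izv, §3] -/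
theorem loc_c₁_fin_of_K_of_sq (h2 : Module.finrank ℚ K = 2) (c₁ : ℕ → galH1Torsion W (lvl M))
    (cK : ℕ → galH1Torsion (W.baseChange K) (lvl M))
    (hres : ∀ m, KolSupp (kolPrime W K M) m → Even m.primeFactors.card →
      resTorsion W K (lvl M) (c₁ m) = cK m)
    (hK43 : ∀ m, KolSupp (kolPrime W K M) m → ∀ w : HeightOneSpectrum (𝓞 K), (m : 𝓞 K) ∉ w.asIdeal →
      cK m ∈ selmerLocalKer (W.baseChange K) (w.adicCompletion K) (lvl M))
    (hdef : ∀ v : HeightOneSpectrum (𝓞 ℚ), ((NumberField.discr K : ℤ) : 𝓞 ℚ) ∈ v.asIdeal →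
      ∀ (w : HeightOneSpectrum (𝓞 K)) [w.asIdeal.LiesOver v.asIdeal], ∀ 𝔔 ∈ w.primesAbove,
        ∀ T : geomTorsion W (lvl M), 2 • T = 0 →
          (∀ g ∈ (𝔔.comap (absIntegersMap ℚ K)).decompositionSubgroup (absoluteGaloisGroup ℚ), g • T = T) →
            T = 0)
    (hres2 : ∀ m, KolSupp (kolPrime W K M) m → Even m.primeFactors.card → ∀ v : HeightOneSpectrum (𝓞 ℚ),
      (m : 𝓞 ℚ) ∉ v.asIdeal →
        (¬ ∃ s : v.adicCompletion ℚ, s ^ 2 = algebraMap ℚ (v.adicCompletion ℚ) (NumberField.discr K : ℤ)) →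
        ((2 : 𝓞 ℚ) ∈ v.asIdeal ∨ ¬ W.HasGoodReductionAt v) →
          c₁ m ∈ selmerLocalKer W (v.adicCompletion ℚ) (lvl M)) :
    ∀ m, KolSupp (kolPrime W K M) m → Even m.primeFactors.card → ∀ v : HeightOneSpectrum (𝓞 ℚ),
      (m : 𝓞 ℚ) ∉ v.asIdeal → c₁ m ∈ selmerLocalKer W (v.adicCompletion ℚ) (lvl M) := by
  intro m hm hev v hmv
  have hK : ∀ (w : HeightOneSpectrum (𝓞 K)) [w.asIdeal.LiesOver v.asIdeal],
      cK m ∈ selmerLocalKer (W.baseChange K) (w.adicCompletion K) (lvl M) := fun w _ ↦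
    hK43 m hm w (intCast_notMem_of_liesOver K v w (n := (m : ℤ)) (by exact_mod_cast hmv) |>
      fun h ↦ by exact_mod_cast h)
  by_cases hsq : ∃ s : v.adicCompletion ℚ, s ^ 2 = algebraMap ℚ (v.adicCompletion ℚ) (NumberField.discr K : ℤ)
  · exact mem_selmerLocalKer_of_K_of_sq W h2 (not_mem_range hθ) hθsq (lvl M) (hres m hm hev) v hsq hK
  · exact loc_c₁_fin_of_K W hθ hθsq h2 c₁ cK hres hK43 hdef
      (fun m' hm' hev' v' hmv' hbad ↦ by
        by_cases hsq' : ∃ s : v'.adicCompletion ℚ, s ^ 2 =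
            algebraMap ℚ (v'.adicCompletion ℚ) (NumberField.discr K : ℤ)
        · exact mem_selmerLocalKer_of_K_of_sq W h2 (not_mem_range hθ) hθsq (lvl M) (hres m' hm' hev') v' hsq'
            (fun w _ ↦ hK43 m' hm' w (intCast_notMem_of_liesOver K v' w (n := (m' : ℤ))
              (by exact_mod_cast hmv') |> fun h ↦ by exact_mod_cast h))
        · exact hres2 m' hm' hev' v' hmv' hsq' hbad)
      m hm hev v hmv

include hθ hθsq in
omit [W.IsElliptic] in
/-- **`Input.loc_c₂_fin` from Lemma 4.3 over `K`**, residual ℚ-hypothesis only where `d_K` is not a square in `ℚ_v`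
and `v ∋ 2`, `v` bad for the twin, or `v ∣ d_K`. [cite: McCallumLMS1991, §4 Lemma 4.3] [cite: Kolyvagin1989Izv, §3] -/
theorem loc_c₂_fin_of_K_of_sq (h2 : Module.finrank ℚ K = 2) [(twin W K).IsElliptic]
    (c₂ : ℕ → galH1Torsion (twin W K) (lvl M)) (cK : ℕ → galH1Torsion (W.baseChange K) (lvl M))
    (hres : ∀ m, KolSupp (kolPrime W K M) m → Odd m.primeFactors.card →
      hPsiKT W K hθ hθsq (lvl M) (resTorsion (twin W K) K (lvl M) (c₂ m)) = cK m)
    (hK43 : ∀ m, KolSupp (kolPrime W K M) m → ∀ w : HeightOneSpectrum (𝓞 K), (m : 𝓞 K) ∉ w.asIdeal →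
      cK m ∈ selmerLocalKer (W.baseChange K) (w.adicCompletion K) (lvl M))
    (hres2 : ∀ m, KolSupp (kolPrime W K M) m → Odd m.primeFactors.card → ∀ v : HeightOneSpectrum (𝓞 ℚ),
      (m : 𝓞 ℚ) ∉ v.asIdeal →
        (¬ ∃ s : v.adicCompletion ℚ, s ^ 2 = algebraMap ℚ (v.adicCompletion ℚ) (NumberField.discr K : ℤ)) →
        ((2 : 𝓞 ℚ) ∈ v.asIdeal ∨ ¬ (twin W K).HasGoodReductionAt v ∨
          ((NumberField.discr K : ℤ) : 𝓞 ℚ) ∈ v.asIdeal) →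
          c₂ m ∈ selmerLocalKer (twin W K) (v.adicCompletion ℚ) (lvl M)) :
    ∀ m, KolSupp (kolPrime W K M) m → Odd m.primeFactors.card → ∀ v : HeightOneSpectrum (𝓞 ℚ),
      (m : 𝓞 ℚ) ∉ v.asIdeal → c₂ m ∈ selmerLocalKer (twin W K) (v.adicCompletion ℚ) (lvl M) := by
  have key : ∀ m, KolSupp (kolPrime W K M) m → Odd m.primeFactors.card → ∀ v : HeightOneSpectrum (𝓞 ℚ),
      (m : 𝓞 ℚ) ∉ v.asIdeal →
        (∃ s : v.adicCompletion ℚ, s ^ 2 = algebraMap ℚ (v.adicCompletion ℚ) (NumberField.discr K : ℤ)) →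
          c₂ m ∈ selmerLocalKer (twin W K) (v.adicCompletion ℚ) (lvl M) := fun m hm hodd v hmv hsq ↦
    mem_selmerLocalKer_twin_of_K_of_sq W h2 (not_mem_range hθ) hθsq hθ hθsq (lvl M) (hres m hm hodd) v hsq
      (fun w _ ↦ hK43 m hm w (intCast_notMem_of_liesOver K v w (n := (m : ℤ)) (by exact_mod_cast hmv) |>
        fun h ↦ by exact_mod_cast h))
  intro m hm hodd v hmv
  by_cases hsq : ∃ s : v.adicCompletion ℚ, s ^ 2 = algebraMap ℚ (v.adicCompletion ℚ) (NumberField.discr K : ℤ)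
  · exact key m hm hodd v hmv hsq
  · exact loc_c₂_fin_of_K W hθ hθsq h2 c₂ cK hres hK43
      (fun m' hm' hodd' v' hmv' hbad ↦ by
        by_cases hsq' : ∃ s : v'.adicCompletion ℚ, s ^ 2 =
            algebraMap ℚ (v'.adicCompletion ℚ) (NumberField.discr K : ℤ)
        · exact key m' hm' hodd' v' hmv' hsq'
        · exact hres2 m' hm' hodd' v' hmv' hsq' hbad)
      m hm hodd v hmv

end Fields

end Summit.BirchSwinnertonDyer.BirchSwinnertonDyer.Theorems.GenusExact.VisiblePairAtTwo

end
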